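import Literature.Algebra.Homology.DiscreteRepCoindPullbackNormal
import HarnessLib

/-!
# Double cosets `U\Γ/φ(W)` map onto the `H`-orbits of a transitive `G`-set through `π : Γ → G`
# (the correspondence «double cosets ↔ places of the fixed field» in its group-theoretic form;
# Neukirch, *Algebraic Number Theory* I §9; Brown, *Cohomology of Groups* III §5)

Topic `Algebra/Homology` (sequel of §1 of bsd-line-x1-p1-w4's `DiscreteRepCoindPullbackNormal`: the
double-coset space `DoubleCosets φ U = U\Γ/φ(W)`, its section `dcRep` and `exists_decomp`); namespace
`Literature.Algebra.Homology.DiscreteRep`.  One definition with body (`dcOrbitMap`) and theorems; no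
named fact, no instance, no notation, no `sorry`.  Pure group theory.

THE STATEMENT.  Let `φ : W →* Γ` and `π : Γ →* G` be group homomorphisms, `U ≤ Γ` and `H ≤ G`
subgroups with `π(U) ≤ H`, and let `G` act on a set `X`; fix `x₀ ∈ X` FIXED by `π(φ(W))`.  Then

* `t ↦ H · (π(s_t) · x₀)` (`s_t = dcRep φ U t` the chosen representative) is a well-defined map
  `dcOrbitMap : U\Γ/φ(W) → H\X` — on the class of `x ∈ Γ` it is the orbit of `π(x) · x₀`
  (`dcOrbitMap_dcMk`; raw form `exists_mem_smul_dcRep_dcMk_eq`: `h · π(s_{[x]}) · x₀ = π(x) · x₀` for some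
  `h ∈ H`);
* if `π` is surjective and `G` is transitive on `X` it is SURJECTIVE (`dcOrbitMap_surjective`; raw form
  **`exists_mem_smul_dcRep_eq`**: every `x ∈ X` is `h · π(s_t) · x₀` for some double coset `t` and some
  `h ∈ H`);
* if moreover `U = π⁻¹(H)` and the stabiliser of `x₀` is contained in `π(φ(W))` it is INJECTIVE
  (`dcOrbitMap_injective`), hence bijective (`dcOrbitMap_bijective`).

This is the group theory behind «the double cosets `Gal(E/L)\Gal(E/K)/D_{w̄}` are the places of `L` above
`v`» (`X` = the places of a Galois extension `E/K` above `v`, transitive under `G = Gal(E/K)`; `x₀ = w̄` with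
decomposition group `D_{w̄} ⊇ π(φ(Γ_{K_v}))`; `H = Gal(E/L)`), Neukirch I §9 p. 54–55 / Cassels–Fröhlich VII
§1.1, in the profinite dress `Γ = G_S`, `φ = φ_v : Γ_{K_v} → G_S`, `U` open normal, used by lane «PT-Ш-S-TC»
of crux `stmt-BirchSwinnertonDyer-19032` (cell bsd-eis; brick [P2-mono], file P2-b (iii) of bsd-line-x1-p1-w8:
«every place of `K_S^U` / of a layer's fixed field above `w ∈ S` is a `u_{w,t}`»).  HONEST FRAMING: bookkeeping;
no arithmetic statement and nothing about BSD is proved here.  AI formalisation, established only by the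
kernel check.

## References
* J. Neukirch, *Algebraic Number Theory* (1999), Ch. I §9 (extensions of Dedekind domains; transitivity of
  the Galois group on the primes above `𝔭`, decomposition groups, p. 54–55). [NeukirchANT1999]
* K. S. Brown, *Cohomology of Groups*, GTM 87 (1982), III §5 (5.6) (double cosets in Mackey's formula).
  [Brown1982CohomologyGroups]
* J. W. S. Cassels, A. Fröhlich (eds.), *Algebraic Number Theory* (1967), Ch. VII (J. Tate) §1.1.
  [CasselsFrohlichANT1967]
-/

universe u v w

namespace Literature.Algebra.Homology

namespace DiscreteRep

section Orbits

variable {Γ W : Type u} [Group Γ] [Group W] (φ : W →* Γ) (U : Subgroup Γ)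
variable {G : Type v} [Group G] (π : Γ →* G) (H : Subgroup G)
variable {X : Type w} [MulAction G X] (x₀ : X)

/-- **The orbit map `U\Γ/φ(W) → H\X`, `t ↦ H · (π(s_t) · x₀)`** (on the chosen representatives `s_t = dcRep φ U t`).
[cite: NeukirchANT1999, Ch. I §9 (p. 54–55)] -/
noncomputable def dcOrbitMap (t : DoubleCosets φ U) : MulAction.orbitRel.Quotient H X :=
  Quotient.mk (MulAction.orbitRel H X) (π (dcRep φ U t) • x₀)

/-- Unfolding of `dcOrbitMap`. [cite: NeukirchANT1999, Ch. I §9] -/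
theorem dcOrbitMap_apply (t : DoubleCosets φ U) :
    dcOrbitMap φ U π H x₀ t = Quotient.mk (MulAction.orbitRel H X) (π (dcRep φ U t) • x₀) := rfl

variable {U H x₀}

/-- **Well-definedness, raw form**: if `π(U) ≤ H` and `π(φ(W))` fixes `x₀`, then for every `x ∈ Γ` there is
`h ∈ H` with `h · (π(s_{[x]}) · x₀) = π(x) · x₀` (from `x = u · s_{[x]} · φ(w)`: take `h = π(u)`).
[cite: NeukirchANT1999, Ch. I §9 (p. 54–55)][cite: Brown1982CohomologyGroups, III §5 (5.6)] -/
theorem exists_mem_smul_dcRep_dcMk_eq (hU : ∀ u ∈ U, π u ∈ H) (hφ : ∀ w : W, π (φ w) • x₀ = x₀) (x : Γ) :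
    ∃ h ∈ H, h • (π (dcRep φ U (dcMk φ U x)) • x₀) = π x • x₀ := by
  obtain ⟨u, w, e⟩ := exists_decomp φ U x
  refine ⟨π u, hU u u.2, ?_⟩
  -- `π x • x₀ = π u • π s • π (φ w) • x₀ = π u • π s • x₀`
  conv_rhs => rw [e]
  rw [map_mul, map_mul, mul_smul, mul_smul, hφ w]

/-- **`dcOrbitMap [x] = H · (π(x) · x₀)`**: the orbit map does not depend on the representative.
[cite: NeukirchANT1999, Ch. I §9 (p. 54–55)] -/
theorem dcOrbitMap_dcMk (hU : ∀ u ∈ U, π u ∈ H) (hφ : ∀ w : W, π (φ w) • x₀ = x₀) (x : Γ) :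
    dcOrbitMap φ U π H x₀ (dcMk φ U x) = Quotient.mk (MulAction.orbitRel H X) (π x • x₀) := by
  obtain ⟨h, hh, e⟩ := exists_mem_smul_dcRep_dcMk_eq φ π hU hφ x
  rw [dcOrbitMap_apply]
  refine Quotient.sound ?_
  -- `orbitRel H X a b ↔ a ∈ orbit H b`
  change _ ∈ MulAction.orbit (↥H) _
  rw [MulAction.mem_orbit_iff]
  refine ⟨⟨h, hh⟩⁻¹, ?_⟩
  rw [Subgroup.smul_def, Subgroup.coe_inv, inv_smul_eq_iff]
  exact e.symm

/-- **Surjectivity, raw form**: if `π` is surjective and `G` acts transitively on `X`, every `x ∈ X` is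
`h · (π(s_t) · x₀)` for some double coset `t ∈ U\Γ/φ(W)` and some `h ∈ H` — i.e. every `H`-orbit of `X` is hit
(with `X` the places of a Galois extension above `v` and `H = Gal(E/L)`: every place of `L` above `v` is a
`u_t`). [cite: NeukirchANT1999, Ch. I §9 (p. 54–55)][cite: CasselsFrohlichANT1967, Ch. VII §1.1] -/
theorem exists_mem_smul_dcRep_eq (hπ : Function.Surjective π) [MulAction.IsPretransitive G X]
    (hU : ∀ u ∈ U, π u ∈ H) (hφ : ∀ w : W, π (φ w) • x₀ = x₀) (x : X) :
    ∃ (t : DoubleCosets φ U) (h : G), h ∈ H ∧ h • (π (dcRep φ U t) • x₀) = x := by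
  obtain ⟨g, hg⟩ := MulAction.exists_smul_eq G x₀ x
  obtain ⟨γ, rfl⟩ := hπ g
  obtain ⟨h, hh, e⟩ := exists_mem_smul_dcRep_dcMk_eq φ π hU hφ γ
  exact ⟨dcMk φ U γ, h, hh, e.trans hg⟩

/-- **The orbit map `U\Γ/φ(W) → H\X` is surjective** (for `π` surjective and `X` transitive).
[cite: NeukirchANT1999, Ch. I §9 (p. 54–55)] -/
theorem dcOrbitMap_surjective (hπ : Function.Surjective π) [MulAction.IsPretransitive G X]
    (hU : ∀ u ∈ U, π u ∈ H) (hφ : ∀ w : W, π (φ w) • x₀ = x₀) :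
    Function.Surjective (dcOrbitMap φ U π H x₀) := by
  intro q
  induction q using Quotient.inductionOn with
  | h x =>
    obtain ⟨t, h, hh, e⟩ := exists_mem_smul_dcRep_eq φ π hπ hU hφ x
    refine ⟨t, ?_⟩
    rw [dcOrbitMap_apply]
    refine Quotient.sound ?_
    change _ ∈ MulAction.orbit (↥H) _
    rw [MulAction.mem_orbit_iff]
    refine ⟨⟨h, hh⟩⁻¹, ?_⟩
    rw [Subgroup.smul_def, Subgroup.coe_inv, inv_smul_eq_iff]
    exact e.symm

/-- **Injectivity**: if `U = π⁻¹(H)` and the stabiliser of `x₀` is contained in `π(φ(W))`, two double cosets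
with the same `H`-orbit coincide (`h π(x) x₀ = π(y) x₀` ⇒ `π(y)⁻¹ h π(x) = π(φ w)` ⇒ `y φ(w) x⁻¹ ∈ π⁻¹(H) = U`).
[cite: NeukirchANT1999, Ch. I §9 (p. 54–55)] -/
theorem dcOrbitMap_injective (hUH : U = H.comap π) (hφ : ∀ w : W, π (φ w) • x₀ = x₀)
    (hstab : ∀ g : G, g • x₀ = x₀ → ∃ w : W, π (φ w) = g) :
    Function.Injective (dcOrbitMap φ U π H x₀) := by
  have hU : ∀ u ∈ U, π u ∈ H := fun u hu => by
    rw [hUH, Subgroup.mem_comap] at hu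
    exact hu
  intro t₁ t₂ h12
  rw [← dcMk_dcRep φ U t₁, ← dcMk_dcRep φ U t₂] at h12 ⊢
  set x := dcRep φ U t₁
  set y := dcRep φ U t₂
  rw [dcOrbitMap_dcMk φ π hU hφ, dcOrbitMap_dcMk φ π hU hφ] at h12
  -- `π x • x₀` and `π y • x₀` lie in one `H`-orbit
  have h12' : π x • x₀ ∈ MulAction.orbit (↥H) (π y • x₀) := Quotient.exact h12
  rw [MulAction.mem_orbit_iff] at h12'
  obtain ⟨⟨h, hh⟩, e⟩ := h12'
  rw [Subgroup.smul_def] at e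
  change h • π y • x₀ = π x • x₀ at e
  -- `(π x)⁻¹ * h * π y` stabilises `x₀`
  have hst : ((π x)⁻¹ * h * π y) • x₀ = x₀ := by
    rw [mul_smul, mul_smul, e, inv_smul_smul]
  obtain ⟨w, hw⟩ := hstab _ hst
  -- so `x * φ w * y⁻¹ ∈ π⁻¹(H) = U`
  have hmem : x * φ w * y⁻¹ ∈ U := by
    rw [hUH, Subgroup.mem_comap, map_mul, map_mul, hw, map_inv]
    have : π x * ((π x)⁻¹ * h * π y) * (π y)⁻¹ = h := by group
    rw [this]
    exact hh
  -- `x · φ w = u · y`, hence `[x] = [x φ w] = [u y] = [y]`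
  have ey : x * φ w = ((⟨x * φ w * y⁻¹, hmem⟩ : U) : Γ) * y := by
    change x * φ w = x * φ w * y⁻¹ * y
    rw [inv_mul_cancel_right]
  rw [← dcMk_mul_right φ U x w, ey, dcMk_mul_left]

/-- **Bijection `U\Γ/φ(W) ≃ H\X`** under all the hypotheses (`π` surjective, `X` transitive, `U = π⁻¹(H)`,
`Stab(x₀) = π(φ(W))`). [cite: NeukirchANT1999, Ch. I §9 (p. 54–55)] -/
theorem dcOrbitMap_bijective (hπ : Function.Surjective π) [MulAction.IsPretransitive G X]
    (hUH : U = H.comap π) (hφ : ∀ w : W, π (φ w) • x₀ = x₀)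
    (hstab : ∀ g : G, g • x₀ = x₀ → ∃ w : W, π (φ w) = g) :
    Function.Bijective (dcOrbitMap φ U π H x₀) :=
  ⟨dcOrbitMap_injective φ π hUH hφ hstab,
    dcOrbitMap_surjective φ π hπ (fun u hu => by rw [hUH, Subgroup.mem_comap] at hu; exact hu) hφ⟩

/-- **Invariant functions are hit**: if `f : X → Y` is constant on `H`-orbits (`f (h • x) = f x` for `h ∈ H`),
then under surjectivity every value `f x` is `f (π(s_t) · x₀)` for some double coset `t` (the form used with
`f = (· restricted to L)` on places: every place of `L` above `v` is `(π(s_t) · w̄)|_L`).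
[cite: NeukirchANT1999, Ch. I §9 (p. 54–55)] -/
theorem exists_apply_dcRep_smul_eq {Y : Sort*} (f : X → Y) (hf : ∀ h ∈ H, ∀ x : X, f (h • x) = f x)
    (hπ : Function.Surjective π) [MulAction.IsPretransitive G X]
    (hU : ∀ u ∈ U, π u ∈ H) (hφ : ∀ w : W, π (φ w) • x₀ = x₀) (x : X) :
    ∃ t : DoubleCosets φ U, f (π (dcRep φ U t) • x₀) = f x := by
  obtain ⟨t, h, hh, e⟩ := exists_mem_smul_dcRep_eq φ π hπ hU hφ x
  exact ⟨t, by rw [← e, hf h hh]⟩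

end Orbits

end DiscreteRep

end Literature.Algebra.Homology
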